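import Literature.MathematicalPhysics.QuantumLattice.KomaTasakiTowerHardLemma
import Literature.MathematicalPhysics.QuantumLattice.KomaTasakiTowerExp

/-!
# Koma–Tasaki 1994, Theorem 2.4 (the Anderson tower): proof

This file discharges the named fact `theorem_2_4` of `KomaTasakiSSB.lean`:
`theorem theorem_2_4_holds : theorem_2_4` (T. Koma, H. Tasaki, *Symmetry breaking and
finite-size effects in quantum many-body systems*, J. Stat. Phys. **76** (1994) 745–803,
`KomaTasaki1994`, Theorem 2.4, proof in Section 5 pp. 783–788).

The proof is KT's:
* hypotheses i)–vi) and (2.24) give the standing hypotheses `TowerState` of Section 5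
  (`C Φ = 0` from vi), `KomaTasakiTowerExp`) and the smallness condition (K+Lcond) for `K + L ≤ 2M`
  (`klCond_of_sq_le`);
* the double-commutator representation the double-commutator identity
  `2 (⟨Φ, (O⁻)^M H (O⁺)^M Φ⟩ - E ‖(O⁺)^M Φ‖²) = ⟨Φ, [(O⁻)^M, [H, (O⁺)^M]] Φ⟩` (reflection by `U`);
* the expansion the double-commutator expansion of the double commutator into `M²(M-1)` terms containing `[O⁻, O⁺] = -2γC`
  and `M²` terms containing `[O⁻, [H, O⁺]]`, each bounded by Lemma `hardLemma` (`KomaTasakiTowerHardLemma`)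
  as in (Bunshi), the lower bound (Bunbo) `‖(O⁺)^M Φ‖² ≥ ½ b_M`, and Lemma `easyLemma` for the ratios
  `b_{M-2}/b_M`, `b_{M-1}/b_M`, giving the final bound (c₃) with
  `c₃ = 24 r² h / μ² + γ h / (8 μ² o²)` (`≥` KT's `24 r² h μ⁻² (1 + γ o⁻² μ⁻² r⁻¹ c₂)` since
  `c₂ ≤ μ²/(192 r)`);
* `M < 0` is the case `-M > 0` for the mirror system `U1System.mirror` (`O⁺ ↔ O⁻`) of
  `KomaTasakiSSBProofs` (where Theorem 2.3 is proved the same way).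

Locators: equation labels such as `(bmDef)`, `(K+Lcond)`, `(dBound1)`, `(OBO2)`, `(Bunshi)` and the
lemma names `easyLemma`/`hardLemma`/`subLemma` (the three lemmas of §5, in this order) are those
of the arXiv source cond-mat/9708132 of `KomaTasaki1994`.

Consumers (2026-08-29): `AndersonTowerOfStates.lean` (KT94 Corollary 2.11 BY NAME for the Heisenberg antiferromagnet and
hard-core lattice bosons, conditional on the named fact `theorem_2_4`) and `AndersonTowerOfStatesUnconditional.lean`, which
feeds `theorem_2_4_holds`; the explicit constant of `TowerState.core`, `c₃ = 24r²h̄/μ² + γh̄/(8μ²ō²)`, is the one quoted there.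
-/

noncomputable section

open Complex Finset
open scoped InnerProductSpace ComplexConjugate

namespace Literature.MathematicalPhysics.QuantumLattice.KomaTasaki

universe u v

variable {Λ : Type u} [Fintype Λ] {E : Type v} [NormedAddCommGroup E] [InnerProductSpace ℂ E]

/-! ### Ring identities -/

section Algebra

omit [Fintype Λ]

/-- Telescoping: `X Y^M - Y^M X = Σ_{m<M} Y^m [X, Y] Y^{M-1-m}` (KT §5, the double-commutator expansion in the proof of Theorem 2.4: the expansions of
`[H, (O⁺)^M]`, `[(O⁻)^M, ·]`, `[O⁻, (O⁺)^m]`). [cite: KomaTasaki1994, §5 proof of Theorem 2.4] -/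
theorem sub_pow_comm_eq_sum {R : Type*} [Ring R] (X Y : R) (M : ℕ) :
    X * Y ^ M - Y ^ M * X = ∑ m ∈ Finset.range M, Y ^ m * (X * Y - Y * X) * Y ^ (M - 1 - m) := by
  induction M with
  | zero => simp
  | succ M ih =>
      have e : X * Y ^ (M + 1) - Y ^ (M + 1) * X =
          (X * Y ^ M - Y ^ M * X) * Y + Y ^ M * (X * Y - Y * X) := by
        rw [pow_succ]; simp only [sub_mul, mul_sub, mul_assoc]; abel
      rw [Finset.sum_range_succ, e, ih, Finset.sum_mul]
      congr 1
      · refine Finset.sum_congr rfl fun m hm => ?_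
        rw [Finset.mem_range] at hm
        rw [mul_assoc, ← pow_succ, show M - 1 - m + 1 = M + 1 - 1 - m by omega]
      · rw [show M + 1 - 1 - M = 0 by omega, pow_zero, mul_one]

/-- `[Q, P^m A P^k] = [Q, P^m] A P^k + P^m [Q, A] P^k + P^m A [Q, P^k]`. [cite: KomaTasaki1994, §5 proof of Theorem 2.4] -/
theorem comm_triple_split {R : Type*} [Ring R] (Q Pm A Pk : R) :
    Q * (Pm * A * Pk) - Pm * A * Pk * Q =
      (Q * Pm - Pm * Q) * A * Pk + Pm * (Q * A - A * Q) * Pk + Pm * A * (Q * Pk - Pk * Q) := by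
  simp only [sub_mul, mul_sub, mul_assoc]; abel

/-- `⟨Φ, (Σ_i f_i) Φ⟩ = Σ_i ⟨Φ, f_i Φ⟩`. [folklore] -/
theorem inner_apply_sum (Φ : E) {ι : Type*} (s : Finset ι) (f : ι → E →L[ℂ] E) :
    ⟪Φ, (∑ i ∈ s, f i) Φ⟫_ℂ = ∑ i ∈ s, ⟪Φ, f i Φ⟫_ℂ := by
  simp only [FunLike.coe_sum, Finset.sum_apply, inner_sum]

/-- `|⟨Φ, (Σ_i f_i) Φ⟩| ≤ Σ_i |⟨Φ, f_i Φ⟩|`. [folklore] -/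
theorem norm_inner_apply_sum_le (Φ : E) {ι : Type*} (s : Finset ι) (f : ι → E →L[ℂ] E) :
    ‖⟪Φ, (∑ i ∈ s, f i) Φ⟫_ℂ‖ ≤ ∑ i ∈ s, ‖⟪Φ, f i Φ⟫_ℂ‖ := by
  rw [inner_apply_sum]; exact norm_sum_le _ _

end Algebra

namespace TowerState

variable {sys : U1System Λ E} {Φ : E} {μ γ : ℝ}

/-! ### The local operators `[H, O⁺]` and `[O⁻, [H, O⁺]]` -/

/-- `[H, O⁺]` is local with constant `4 r o h` ((Bunshi): "`δ([H, O⁺]; …)`" with `a = 4roh`).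
[cite: KomaTasaki1994, §5 proof of Theorem 2.4, (Bunshi)] -/
theorem isLocal_comm_H_orderPlus (sys : U1System Λ E) :
    sys.IsLocal (sys.hamiltonian * sys.orderPlus - sys.orderPlus * sys.hamiltonian)
      (4 * sys.r * sys.obar * sys.hbar) := by
  have h := (sys.isLocal_hamiltonian.comm_sgnOp true).neg
  simpa [neg_sub] using h

/-- `H` has charge `0` ((2.12)). [cite: KomaTasaki1994, (2.12)] -/
theorem hasCharge_hamiltonian (sys : U1System Λ E) : sys.HasCharge sys.hamiltonian 0 := by
  rw [U1System.HasCharge, Int.cast_zero, zero_smul, sub_eq_zero]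
  exact sys.commute_hamiltonian.eq.symm

/-- `[H, O⁺]` has charge `+1`. [cite: KomaTasaki1994, §5 proof of Theorem 2.4] -/
theorem hasCharge_comm_H_orderPlus (sys : U1System Λ E) :
    sys.HasCharge (sys.hamiltonian * sys.orderPlus - sys.orderPlus * sys.hamiltonian) 1 := by
  have h := ((hasCharge_hamiltonian sys).comm_sgnOp true).neg
  simpa [neg_sub] using h

/-- `[O⁻, [H, O⁺]]` is local with constant `4 r o (4 r o h) = 16 r² o² h` ((Bunshi)).
[cite: KomaTasaki1994, §5 proof of Theorem 2.4, (Bunshi)] -/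
theorem isLocal_comm2 (sys : U1System Λ E) :
    sys.IsLocal (sys.orderMinus * (sys.hamiltonian * sys.orderPlus - sys.orderPlus * sys.hamiltonian) -
        (sys.hamiltonian * sys.orderPlus - sys.orderPlus * sys.hamiltonian) * sys.orderMinus)
      (4 * sys.r * sys.obar * (4 * sys.r * sys.obar * sys.hbar)) := by
  simpa using (isLocal_comm_H_orderPlus sys).comm_sgnOp false

/-- `[O⁻, [H, O⁺]]` has charge `0`. [cite: KomaTasaki1994, §5 proof of Theorem 2.4] -/
theorem hasCharge_comm2 (sys : U1System Λ E) :
    sys.HasCharge (sys.orderMinus * (sys.hamiltonian * sys.orderPlus - sys.orderPlus * sys.hamiltonian) -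
        (sys.hamiltonian * sys.orderPlus - sys.orderPlus * sys.hamiltonian) * sys.orderMinus) 0 := by
  simpa using (hasCharge_comm_H_orderPlus sys).comm_sgnOp false

/-- Inserting `C`: `⟨Φ, Y C X Φ⟩ = charge(X) ⟨Φ, Y X Φ⟩` when `C Φ = 0` ("`O^±` are the raising and
lowering operators", the double-commutator expansion→(Bunshi)). [cite: KomaTasaki1994, §5 proof of Theorem 2.4, (Bunshi)] -/
theorem inner_mul_C_mul (hT : TowerState sys Φ μ γ) {X : E →L[ℂ] E} {q : ℤ} (hX : sys.HasCharge X q)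
    (Y : E →L[ℂ] E) : ⟪Φ, (Y * sys.C * X) Φ⟫_ℂ = (q : ℂ) * ⟪Φ, (Y * X) Φ⟫_ℂ := by
  rw [mul_apply_eq_comp, mul_apply_eq_comp, hX.C_apply hT.C_apply, map_smul, mul_apply_eq_comp,
    inner_smul_right]

/-! ### The three types of terms in the expansion of `⟨Φ, [(O⁻)^M, [H, (O⁺)^M]] Φ⟩` -/

/-- **Type II terms (double-commutator expansion, middle line):** `|⟨Φ, Q^l P^m [Q, [H, P]] P^{M-1-m} Q^{M-1-l} Φ⟩| ≤ 3 δ([Q,[H,P]]; M-1, M-1)`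
(`P = O⁺`, `Q = O⁻`). [cite: KomaTasaki1994, §5 proof of Theorem 2.4, (Bunshi)] -/
theorem termII_le (hT : TowerState sys Φ μ γ) {M : ℕ} (hKL : KLCond sys μ γ (2 * M)) {l m : ℕ}
    (hl : l < M) (hm : m < M) :
    ‖⟪Φ, (sys.orderMinus ^ l * sys.orderPlus ^ m *
        (sys.orderMinus * (sys.hamiltonian * sys.orderPlus - sys.orderPlus * sys.hamiltonian) -
          (sys.hamiltonian * sys.orderPlus - sys.orderPlus * sys.hamiltonian) * sys.orderMinus) *
        sys.orderPlus ^ (M - 1 - m) * sys.orderMinus ^ (M - 1 - l)) Φ⟫_ℂ‖ ≤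
      3 * delta sys Φ (4 * sys.r * sys.obar * (4 * sys.r * sys.obar * sys.hbar)) (M - 1) (M - 1) := by
  have e : sys.orderMinus ^ l * sys.orderPlus ^ m *
        (sys.orderMinus * (sys.hamiltonian * sys.orderPlus - sys.orderPlus * sys.hamiltonian) -
          (sys.hamiltonian * sys.orderPlus - sys.orderPlus * sys.hamiltonian) * sys.orderMinus) *
        sys.orderPlus ^ (M - 1 - m) * sys.orderMinus ^ (M - 1 - l) =
      sys.wordOp (List.replicate l false ++ List.replicate m true) *
        (sys.orderMinus * (sys.hamiltonian * sys.orderPlus - sys.orderPlus * sys.hamiltonian) -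
          (sys.hamiltonian * sys.orderPlus - sys.orderPlus * sys.hamiltonian) * sys.orderMinus) *
        sys.wordOp (List.replicate (M - 1 - m) true ++ List.replicate (M - 1 - l) false) := by
    simp only [U1System.wordOp_append, U1System.wordOp_replicate, U1System.sgnOp_true,
      U1System.sgnOp_false, mul_assoc]
  rw [e]
  refine hT.norm_inner_sandwich_word_le (K := M - 1) (L := M - 1) (hT.klCond_mono (by omega) hKL)
    (isLocal_comm2 sys) (by simpa using hasCharge_comm2 sys) _ _ ?_ ?_
  · simp [List.count_append]; omega
  · simp [List.count_append]; omega

/-- **Type I terms (double-commutator expansion, first line):**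
`|⟨Φ, Q^l (P^n [Q,P] P^{m-1-n}) [H,P] P^{M-1-m} Q^{M-1-l} Φ⟩| ≤ 2γ M · 3 δ([H,P]; M-2, M-1)`, using
`[Q, P] = -2γ C` and `C X Φ = charge(X) X Φ` with `|charge| ≤ M`. [cite: KomaTasaki1994, §5 proof of Theorem 2.4, (Bunshi)] -/
theorem termI_le (hT : TowerState sys Φ μ γ) {M : ℕ} (hKL : KLCond sys μ γ (2 * M)) {l m n : ℕ}
    (hl : l < M) (hm : m < M) (hn : n < m) :
    ‖⟪Φ, (sys.orderMinus ^ l *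
        (sys.orderPlus ^ n * (sys.orderMinus * sys.orderPlus - sys.orderPlus * sys.orderMinus) *
          sys.orderPlus ^ (m - 1 - n)) *
        (sys.hamiltonian * sys.orderPlus - sys.orderPlus * sys.hamiltonian) *
        sys.orderPlus ^ (M - 1 - m) * sys.orderMinus ^ (M - 1 - l)) Φ⟫_ℂ‖ ≤
      2 * γ * M * (3 * delta sys Φ (4 * sys.r * sys.obar * sys.hbar) (M - 2) (M - 1)) := by
  set A₁ := sys.hamiltonian * sys.orderPlus - sys.orderPlus * sys.hamiltonian with hA₁
  set X := sys.orderPlus ^ (m - 1 - n) * A₁ * sys.orderPlus ^ (M - 1 - m) * sys.orderMinus ^ (M - 1 - l)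
    with hX
  have e1 : sys.orderMinus ^ l *
        (sys.orderPlus ^ n * (-((2 * (γ : ℂ)) • sys.C)) * sys.orderPlus ^ (m - 1 - n)) * A₁ *
        sys.orderPlus ^ (M - 1 - m) * sys.orderMinus ^ (M - 1 - l) =
      -((2 * (γ : ℂ)) • ((sys.orderMinus ^ l * sys.orderPlus ^ n) * sys.C * X)) := by
    simp only [hX, mul_neg, neg_mul, mul_smul_comm, smul_mul_assoc, mul_assoc]
  have hq : sys.HasCharge X (((m - 1 - n : ℕ) : ℤ) * 1 + 1 + ((M - 1 - m : ℕ) : ℤ) * 1 +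
      ((M - 1 - l : ℕ) : ℤ) * (-1)) := by
    have h1 := (sys.hasCharge_sgnOp true).pow (m - 1 - n)
    have h2 := hasCharge_comm_H_orderPlus sys
    have h3 := (sys.hasCharge_sgnOp true).pow (M - 1 - m)
    have h4 := (sys.hasCharge_sgnOp false).pow (M - 1 - l)
    simp only [U1System.sgnOp_true, U1System.sgnOp_false, U1System.bsign_true,
      U1System.bsign_false] at h1 h3 h4
    exact ((h1.mul h2).mul h3).mul h4
  have hγ : ‖(2 * (γ : ℂ))‖ = 2 * γ := by
    rw [norm_mul, Complex.norm_ofNat, Complex.norm_real, Real.norm_eq_abs, abs_of_pos hT.gamma_pos]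
  rw [hT.comm_orderMinus_orderPlus, e1, neg_apply, inner_neg_right, norm_neg, smul_apply,
    inner_smul_right, hT.inner_mul_C_mul hq, norm_mul (2 * (γ : ℂ)), hγ, norm_mul, Complex.norm_intCast]
  have hqM : |((((m - 1 - n : ℕ) : ℤ) * 1 + 1 + ((M - 1 - m : ℕ) : ℤ) * 1 +
      ((M - 1 - l : ℕ) : ℤ) * (-1) : ℤ) : ℝ)| ≤ M := by
    rw [← Int.cast_abs]
    have : |(((m - 1 - n : ℕ) : ℤ) * 1 + 1 + ((M - 1 - m : ℕ) : ℤ) * 1 + ((M - 1 - l : ℕ) : ℤ) * (-1))| ≤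
        (M : ℤ) := by
      rw [abs_le]; constructor <;> omega
    exact_mod_cast this
  -- the remaining sandwich
  have e2 : sys.orderMinus ^ l * sys.orderPlus ^ n * X =
      sys.wordOp (List.replicate l false ++ List.replicate (n + (m - 1 - n)) true) * A₁ *
        sys.wordOp (List.replicate (M - 1 - m) true ++ List.replicate (M - 1 - l) false) := by
    simp only [hX, U1System.wordOp_append, U1System.wordOp_replicate, U1System.sgnOp_true,
      U1System.sgnOp_false, pow_add, mul_assoc]
  have hsand : ‖⟪Φ, (sys.orderMinus ^ l * sys.orderPlus ^ n * X) Φ⟫_ℂ‖ ≤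
      3 * delta sys Φ (4 * sys.r * sys.obar * sys.hbar) (M - 2) (M - 1) := by
    rw [e2]
    refine hT.norm_inner_sandwich_word_le (K := M - 2) (L := M - 1) (hT.klCond_mono (by omega) hKL)
      (isLocal_comm_H_orderPlus sys) ?_ _ _ ?_ ?_
    · rw [show ((M - 1 : ℕ) : ℤ) - ((M - 2 : ℕ) : ℤ) = 1 by omega]
      exact hasCharge_comm_H_orderPlus sys
    · simp [List.count_append]; omega
    · simp [List.count_append]; omega
  have h2γ : 0 ≤ 2 * γ := by have := hT.gamma_pos; positivity
  calc 2 * γ * (|((((m - 1 - n : ℕ) : ℤ) * 1 + 1 + ((M - 1 - m : ℕ) : ℤ) * 1 +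
        ((M - 1 - l : ℕ) : ℤ) * (-1) : ℤ) : ℝ)| * ‖⟪Φ, (sys.orderMinus ^ l * sys.orderPlus ^ n * X) Φ⟫_ℂ‖)
      ≤ 2 * γ * (M * (3 * delta sys Φ (4 * sys.r * sys.obar * sys.hbar) (M - 2) (M - 1))) := by
        apply mul_le_mul_of_nonneg_left _ h2γ
        exact mul_le_mul hqM hsand (norm_nonneg _) (Nat.cast_nonneg M)
    _ = _ := by ring

/-- **Type III terms (double-commutator expansion, last line):**
`|⟨Φ, Q^l P^m [H,P] (P^n [Q,P] P^{M-2-m-n}) Q^{M-1-l} Φ⟩| ≤ 2γ M · 3 δ([H,P]; M-2, M-1)`.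
[cite: KomaTasaki1994, §5 proof of Theorem 2.4, (Bunshi)] -/
theorem termIII_le (hT : TowerState sys Φ μ γ) {M : ℕ} (hKL : KLCond sys μ γ (2 * M)) {l m n : ℕ}
    (hl : l < M) (hm : m < M) (hn : n < M - 1 - m) :
    ‖⟪Φ, (sys.orderMinus ^ l * sys.orderPlus ^ m *
        (sys.hamiltonian * sys.orderPlus - sys.orderPlus * sys.hamiltonian) *
        (sys.orderPlus ^ n * (sys.orderMinus * sys.orderPlus - sys.orderPlus * sys.orderMinus) *
          sys.orderPlus ^ (M - 1 - m - 1 - n)) * sys.orderMinus ^ (M - 1 - l)) Φ⟫_ℂ‖ ≤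
      2 * γ * M * (3 * delta sys Φ (4 * sys.r * sys.obar * sys.hbar) (M - 2) (M - 1)) := by
  set A₁ := sys.hamiltonian * sys.orderPlus - sys.orderPlus * sys.hamiltonian with hA₁
  set X := sys.orderPlus ^ (M - 1 - m - 1 - n) * sys.orderMinus ^ (M - 1 - l) with hX
  set Y := sys.orderMinus ^ l * sys.orderPlus ^ m * A₁ * sys.orderPlus ^ n with hY
  have e1 : sys.orderMinus ^ l * sys.orderPlus ^ m * A₁ *
        (sys.orderPlus ^ n * (-((2 * (γ : ℂ)) • sys.C)) * sys.orderPlus ^ (M - 1 - m - 1 - n)) *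
        sys.orderMinus ^ (M - 1 - l) =
      -((2 * (γ : ℂ)) • (Y * sys.C * X)) := by
    simp only [hX, hY, mul_neg, neg_mul, mul_smul_comm, smul_mul_assoc, mul_assoc]
  have hq : sys.HasCharge X (((M - 1 - m - 1 - n : ℕ) : ℤ) * 1 + ((M - 1 - l : ℕ) : ℤ) * (-1)) := by
    have h3 := (sys.hasCharge_sgnOp true).pow (M - 1 - m - 1 - n)
    have h4 := (sys.hasCharge_sgnOp false).pow (M - 1 - l)
    simp only [U1System.sgnOp_true, U1System.sgnOp_false, U1System.bsign_true,
      U1System.bsign_false] at h3 h4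
    exact h3.mul h4
  have hγ : ‖(2 * (γ : ℂ))‖ = 2 * γ := by
    rw [norm_mul, Complex.norm_ofNat, Complex.norm_real, Real.norm_eq_abs, abs_of_pos hT.gamma_pos]
  rw [hT.comm_orderMinus_orderPlus, e1, neg_apply, inner_neg_right, norm_neg, smul_apply,
    inner_smul_right, hT.inner_mul_C_mul hq, norm_mul (2 * (γ : ℂ)), hγ, norm_mul, Complex.norm_intCast]
  have hqM : |((((M - 1 - m - 1 - n : ℕ) : ℤ) * 1 + ((M - 1 - l : ℕ) : ℤ) * (-1) : ℤ) : ℝ)| ≤ M := by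
    rw [← Int.cast_abs]
    have : |(((M - 1 - m - 1 - n : ℕ) : ℤ) * 1 + ((M - 1 - l : ℕ) : ℤ) * (-1))| ≤ (M : ℤ) := by
      rw [abs_le]; constructor <;> omega
    exact_mod_cast this
  have e2 : Y * X =
      sys.wordOp (List.replicate l false ++ List.replicate m true) * A₁ *
        sys.wordOp (List.replicate (n + (M - 1 - m - 1 - n)) true ++ List.replicate (M - 1 - l) false) := by
    simp only [hX, hY, U1System.wordOp_append, U1System.wordOp_replicate, U1System.sgnOp_true,
      U1System.sgnOp_false, pow_add, mul_assoc]
  have hsand : ‖⟪Φ, (Y * X) Φ⟫_ℂ‖ ≤ 3 * delta sys Φ (4 * sys.r * sys.obar * sys.hbar) (M - 2) (M - 1) := by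
    rw [e2]
    refine hT.norm_inner_sandwich_word_le (K := M - 2) (L := M - 1) (hT.klCond_mono (by omega) hKL)
      (isLocal_comm_H_orderPlus sys) ?_ _ _ ?_ ?_
    · rw [show ((M - 1 : ℕ) : ℤ) - ((M - 2 : ℕ) : ℤ) = 1 by omega]
      exact hasCharge_comm_H_orderPlus sys
    · simp [List.count_append]; omega
    · simp [List.count_append]; omega
  have h2γ : 0 ≤ 2 * γ := by have := hT.gamma_pos; positivity
  calc 2 * γ * (|((((M - 1 - m - 1 - n : ℕ) : ℤ) * 1 + ((M - 1 - l : ℕ) : ℤ) * (-1) : ℤ) : ℝ)| *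
        ‖⟪Φ, (Y * X) Φ⟫_ℂ‖)
      ≤ 2 * γ * (M * (3 * delta sys Φ (4 * sys.r * sys.obar * sys.hbar) (M - 2) (M - 1))) := by
        apply mul_le_mul_of_nonneg_left _ h2γ
        exact mul_le_mul hqM hsand (norm_nonneg _) (Nat.cast_nonneg M)
    _ = _ := by ring

/-! ### Summing the expansion (Bunshi) -/

/-- **(Bunshi), per `(l, m)`:** `|⟨Φ, Q^l [Q, P^m [H,P] P^{M-1-m}] Q^{M-1-l} Φ⟩| ≤ (M-1) β₁ + 3δ₂`
with `β₁ = 2γM · 3δ([H,P]; M-2, M-1)`, `δ₂ = δ([Q,[H,P]]; M-1, M-1)`. [cite: KomaTasaki1994, §5 proof of Theorem 2.4, (Bunshi)] -/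
theorem term_lm_le (hT : TowerState sys Φ μ γ) {M : ℕ} (hKL : KLCond sys μ γ (2 * M)) {l m : ℕ}
    (hl : l < M) (hm : m < M) :
    ‖⟪Φ, (sys.orderMinus ^ l *
        (sys.orderMinus * (sys.orderPlus ^ m *
            (sys.hamiltonian * sys.orderPlus - sys.orderPlus * sys.hamiltonian) *
            sys.orderPlus ^ (M - 1 - m)) -
          sys.orderPlus ^ m * (sys.hamiltonian * sys.orderPlus - sys.orderPlus * sys.hamiltonian) *
            sys.orderPlus ^ (M - 1 - m) * sys.orderMinus) *
        sys.orderMinus ^ (M - 1 - l)) Φ⟫_ℂ‖ ≤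
      (M - 1 : ℝ) * (2 * γ * M * (3 * delta sys Φ (4 * sys.r * sys.obar * sys.hbar) (M - 2) (M - 1))) +
        3 * delta sys Φ (4 * sys.r * sys.obar * (4 * sys.r * sys.obar * sys.hbar)) (M - 1) (M - 1) := by
  set P := sys.orderPlus with hP
  set Q := sys.orderMinus with hQ
  set A₁ := sys.hamiltonian * sys.orderPlus - sys.orderPlus * sys.hamiltonian with hA₁
  set β₁ := 2 * γ * M * (3 * delta sys Φ (4 * sys.r * sys.obar * sys.hbar) (M - 2) (M - 1)) with hβ₁
  set δ₂ := delta sys Φ (4 * sys.r * sys.obar * (4 * sys.r * sys.obar * sys.hbar)) (M - 1) (M - 1) with hδ₂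
  rw [comm_triple_split Q (P ^ m) A₁ (P ^ (M - 1 - m)), sub_pow_comm_eq_sum Q P m,
    sub_pow_comm_eq_sum Q P (M - 1 - m)]
  -- distribute
  have eI : Q ^ l * ((∑ n ∈ Finset.range m, P ^ n * (Q * P - P * Q) * P ^ (m - 1 - n)) * A₁ *
        P ^ (M - 1 - m)) * Q ^ (M - 1 - l) =
      ∑ n ∈ Finset.range m, Q ^ l * (P ^ n * (Q * P - P * Q) * P ^ (m - 1 - n)) * A₁ *
        P ^ (M - 1 - m) * Q ^ (M - 1 - l) := by
    simp only [Finset.sum_mul, Finset.mul_sum, mul_assoc]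
  have eIII : Q ^ l * (P ^ m * A₁ *
        ∑ n ∈ Finset.range (M - 1 - m), P ^ n * (Q * P - P * Q) * P ^ (M - 1 - m - 1 - n)) *
        Q ^ (M - 1 - l) =
      ∑ n ∈ Finset.range (M - 1 - m), Q ^ l * P ^ m * A₁ *
        (P ^ n * (Q * P - P * Q) * P ^ (M - 1 - m - 1 - n)) * Q ^ (M - 1 - l) := by
    simp only [Finset.sum_mul, Finset.mul_sum, mul_assoc]
  rw [mul_add, mul_add, add_mul, add_mul, eI, eIII, add_apply, add_apply, inner_add_right,
    inner_add_right]
  have hI : ‖⟪Φ, (∑ n ∈ Finset.range m, Q ^ l * (P ^ n * (Q * P - P * Q) * P ^ (m - 1 - n)) * A₁ *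
        P ^ (M - 1 - m) * Q ^ (M - 1 - l)) Φ⟫_ℂ‖ ≤ m * β₁ := by
    refine (norm_inner_apply_sum_le Φ _ _).trans ?_
    calc _ ≤ ∑ _n ∈ Finset.range m, β₁ := Finset.sum_le_sum fun n hn =>
            hT.termI_le hKL hl hm (Finset.mem_range.mp hn)
      _ = m * β₁ := by rw [Finset.sum_const, Finset.card_range, nsmul_eq_mul]
  have hII : ‖⟪Φ, (Q ^ l * (P ^ m * (Q * A₁ - A₁ * Q) * P ^ (M - 1 - m)) * Q ^ (M - 1 - l)) Φ⟫_ℂ‖ ≤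
      3 * δ₂ := by
    have e : Q ^ l * (P ^ m * (Q * A₁ - A₁ * Q) * P ^ (M - 1 - m)) * Q ^ (M - 1 - l) =
        Q ^ l * P ^ m * (Q * A₁ - A₁ * Q) * P ^ (M - 1 - m) * Q ^ (M - 1 - l) := by
      simp only [mul_assoc]
    rw [e]
    exact hT.termII_le hKL hl hm
  have hIII : ‖⟪Φ, (∑ n ∈ Finset.range (M - 1 - m), Q ^ l * P ^ m * A₁ *
        (P ^ n * (Q * P - P * Q) * P ^ (M - 1 - m - 1 - n)) * Q ^ (M - 1 - l)) Φ⟫_ℂ‖ ≤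
      ((M - 1 - m : ℕ) : ℝ) * β₁ := by
    refine (norm_inner_apply_sum_le Φ _ _).trans ?_
    calc _ ≤ ∑ _n ∈ Finset.range (M - 1 - m), β₁ := Finset.sum_le_sum fun n hn =>
            hT.termIII_le hKL hl hm (Finset.mem_range.mp hn)
      _ = ((M - 1 - m : ℕ) : ℝ) * β₁ := by rw [Finset.sum_const, Finset.card_range, nsmul_eq_mul]
  have hcount : (m : ℝ) + ((M - 1 - m : ℕ) : ℝ) = M - 1 := by
    have : m + (M - 1 - m) = M - 1 := by omega
    have h1 : (1 : ℝ) ≤ M := by exact_mod_cast (show 1 ≤ M by omega)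
    rw [← Nat.cast_add, this, Nat.cast_sub (by omega)]; simp
  calc _ ≤ ‖⟪Φ, (∑ n ∈ Finset.range m, Q ^ l * (P ^ n * (Q * P - P * Q) * P ^ (m - 1 - n)) * A₁ *
          P ^ (M - 1 - m) * Q ^ (M - 1 - l)) Φ⟫_ℂ +
          ⟪Φ, (Q ^ l * (P ^ m * (Q * A₁ - A₁ * Q) * P ^ (M - 1 - m)) * Q ^ (M - 1 - l)) Φ⟫_ℂ‖ +
        ‖⟪Φ, (∑ n ∈ Finset.range (M - 1 - m), Q ^ l * P ^ m * A₁ *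
          (P ^ n * (Q * P - P * Q) * P ^ (M - 1 - m - 1 - n)) * Q ^ (M - 1 - l)) Φ⟫_ℂ‖ :=
        norm_add_le _ _
    _ ≤ (m * β₁ + 3 * δ₂) + ((M - 1 - m : ℕ) : ℝ) * β₁ :=
        add_le_add ((norm_add_le _ _).trans (add_le_add hI hII)) hIII
    _ = (M - 1 : ℝ) * β₁ + 3 * δ₂ := by rw [← hcount]; ring

/-- **(Bunshi):** the double commutator is bounded by
`|⟨Φ, [(O⁻)^M, [H, (O⁺)^M]] Φ⟩| ≤ M² ((M-1) · 2γM · 3δ([H,O⁺]; M-2, M-1) + 3 δ([O⁻,[H,O⁺]]; M-1, M-1))`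
(`≤ 6γ M⁴ δ(…) + 3 M² δ(…)`, KT (Bunshi)). [cite: KomaTasaki1994, §5 proof of Theorem 2.4, (Bunshi)] -/
theorem norm_double_comm_le (hT : TowerState sys Φ μ γ) {M : ℕ} (hKL : KLCond sys μ γ (2 * M)) :
    ‖⟪Φ, (sys.orderMinus ^ M * (sys.hamiltonian * sys.orderPlus ^ M - sys.orderPlus ^ M * sys.hamiltonian) -
        (sys.hamiltonian * sys.orderPlus ^ M - sys.orderPlus ^ M * sys.hamiltonian) * sys.orderMinus ^ M)
        Φ⟫_ℂ‖ ≤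
      (M : ℝ) * (M * ((M - 1 : ℝ) * (2 * γ * M *
          (3 * delta sys Φ (4 * sys.r * sys.obar * sys.hbar) (M - 2) (M - 1))) +
        3 * delta sys Φ (4 * sys.r * sys.obar * (4 * sys.r * sys.obar * sys.hbar)) (M - 1) (M - 1))) := by
  set P := sys.orderPlus with hP
  set Q := sys.orderMinus with hQ
  set H := sys.hamiltonian with hH
  set A₁ := H * P - P * H with hA₁
  set Z := H * P ^ M - P ^ M * H with hZ
  set bnd := (M - 1 : ℝ) * (2 * γ * M * (3 * delta sys Φ (4 * sys.r * sys.obar * sys.hbar) (M - 2) (M - 1))) +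
    3 * delta sys Φ (4 * sys.r * sys.obar * (4 * sys.r * sys.obar * sys.hbar)) (M - 1) (M - 1) with hbnd
  -- `[Q^M, Z] = Σ_l Q^l [Q, Z] Q^{M-1-l}`
  have e1 : Q ^ M * Z - Z * Q ^ M = ∑ l ∈ Finset.range M, Q ^ l * (Q * Z - Z * Q) * Q ^ (M - 1 - l) := by
    have h := sub_pow_comm_eq_sum Z Q M
    rw [← neg_sub, h, ← Finset.sum_neg_distrib]
    refine Finset.sum_congr rfl fun l _ => ?_
    rw [← neg_sub (Q * Z) (Z * Q), mul_neg, neg_mul, neg_neg]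
  -- `[Q, Z] = Σ_m [Q, W_m]`
  have e2 : Q * Z - Z * Q = ∑ m ∈ Finset.range M,
      (Q * (P ^ m * A₁ * P ^ (M - 1 - m)) - P ^ m * A₁ * P ^ (M - 1 - m) * Q) := by
    rw [hZ, sub_pow_comm_eq_sum H P M, Finset.mul_sum, Finset.sum_mul, ← Finset.sum_sub_distrib]
  rw [e1]
  refine (norm_inner_apply_sum_le Φ _ _).trans ?_
  calc ∑ l ∈ Finset.range M, ‖⟪Φ, (Q ^ l * (Q * Z - Z * Q) * Q ^ (M - 1 - l)) Φ⟫_ℂ‖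
      ≤ ∑ _l ∈ Finset.range M, (M : ℝ) * bnd := by
        refine Finset.sum_le_sum fun l hl => ?_
        rw [Finset.mem_range] at hl
        rw [e2, Finset.mul_sum, Finset.sum_mul]
        refine (norm_inner_apply_sum_le Φ _ _).trans ?_
        calc _ ≤ ∑ _m ∈ Finset.range M, bnd := Finset.sum_le_sum fun m hm =>
                hT.term_lm_le hKL hl (Finset.mem_range.mp hm)
          _ = M * bnd := by rw [Finset.sum_const, Finset.card_range, nsmul_eq_mul]
    _ = M * (M * bnd) := by rw [Finset.sum_const, Finset.card_range, nsmul_eq_mul]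

/-! ### The double-commutator representation the double-commutator identity -/

/-- `⟨(O⁺)^M Φ, y⟩ = ⟨Φ, (O⁻)^M y⟩`. [cite: KomaTasaki1994, §5 proof of Theorem 2.4] -/
theorem inner_orderPlus_pow_left (sys : U1System Λ E) (M : ℕ) (x y : E) :
    ⟪(sys.orderPlus ^ M) x, y⟫_ℂ = ⟪x, (sys.orderMinus ^ M) y⟫_ℂ := by
  have h := sys.inner_wordOp_left (List.replicate M true) x y
  simpa [U1System.wordOp_replicate] using h

/-- **The double-commutator identity:** `2 (⟨(O⁺)^M Φ, H (O⁺)^M Φ⟩ - E ⟨(O⁺)^M Φ, (O⁺)^M Φ⟩) = ⟨Φ, [(O⁻)^M, [H, (O⁺)^M]] Φ⟩`, using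
`H Φ = E Φ`, the symmetry of `H`, and the reflection `U` of hypothesis vi)
(`⟨Φ, (O⁻)^M X (O⁺)^M Φ⟩ = ⟨Φ, (O⁺)^M X (O⁻)^M Φ⟩` for `X = H, 1`). [cite: KomaTasaki1994, §5 proof of Theorem 2.4] -/
theorem two_mul_sub_eq_inner_double_comm [CompleteSpace E] (hT : TowerState sys Φ μ γ) {EΛ : ℝ}
    (hH : sys.hamiltonian Φ = (EΛ : ℂ) • Φ) {c : ℂ} (hc : sys.rotation γ Φ = c • Φ)
    (hUH : sys.rotation γ * sys.hamiltonian = sys.hamiltonian * sys.rotation γ) (M : ℕ) :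
    2 * (⟪(sys.orderPlus ^ M) Φ, sys.hamiltonian ((sys.orderPlus ^ M) Φ)⟫_ℂ -
        (EΛ : ℂ) * ⟪(sys.orderPlus ^ M) Φ, (sys.orderPlus ^ M) Φ⟫_ℂ) =
      ⟪Φ, (sys.orderMinus ^ M * (sys.hamiltonian * sys.orderPlus ^ M - sys.orderPlus ^ M * sys.hamiltonian) -
        (sys.hamiltonian * sys.orderPlus ^ M - sys.orderPlus ^ M * sys.hamiltonian) * sys.orderMinus ^ M)
        Φ⟫_ℂ := by
  set P := sys.orderPlus with hP
  set Q := sys.orderMinus with hQ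
  set H := sys.hamiltonian with hH'
  have hΦ0 := hT.ne_zero
  have hHs : ∀ x y : E, ⟪H x, y⟫_ℂ = ⟪x, H y⟫_ℂ := sys.isSymmetric_hamiltonian
  -- reflections
  have r1 : ⟪Φ, (Q ^ M * H * P ^ M) Φ⟫_ℂ = ⟪Φ, (P ^ M * H * Q ^ M) Φ⟫_ℂ :=
    U1System.inner_eq_inner_of_rotation γ hΦ0 hc
      (U1System.rotation_mul_pow_mul_pow hT.gamma_pos hT.comm hUH M M)
  have r0 : ⟪Φ, (Q ^ M * P ^ M) Φ⟫_ℂ = ⟪Φ, (P ^ M * Q ^ M) Φ⟫_ℂ := by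
    have h := U1System.inner_eq_inner_of_rotation γ hΦ0 hc
      (U1System.rotation_mul_pow_mul_pow hT.gamma_pos hT.comm (X := 1)
        (by rw [mul_one, one_mul]) M M)
    simpa only [mul_one] using h
  -- the four terms
  have t1 : ⟪P ^ M • Φ, H ((P ^ M) Φ)⟫_ℂ = ⟪Φ, (Q ^ M * H * P ^ M) Φ⟫_ℂ := by
    rw [ContinuousLinearMap.smul_def, inner_orderPlus_pow_left, mul_apply_eq_comp, mul_apply_eq_comp]
  have t0 : ⟪(P ^ M) Φ, (P ^ M) Φ⟫_ℂ = ⟪Φ, (Q ^ M * P ^ M) Φ⟫_ℂ := by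
    rw [inner_orderPlus_pow_left, mul_apply_eq_comp]
  have t2 : ⟪Φ, (Q ^ M * P ^ M * H) Φ⟫_ℂ = (EΛ : ℂ) * ⟪Φ, (Q ^ M * P ^ M) Φ⟫_ℂ := by
    rw [mul_apply_eq_comp, hH, map_smul, inner_smul_right]
  have t3 : ⟪Φ, (H * P ^ M * Q ^ M) Φ⟫_ℂ = (EΛ : ℂ) * ⟪Φ, (Q ^ M * P ^ M) Φ⟫_ℂ := by
    rw [mul_assoc, mul_apply_eq_comp, ← hHs, hH, inner_smul_left, Complex.conj_ofReal, r0]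
  have e : Q ^ M * (H * P ^ M - P ^ M * H) - (H * P ^ M - P ^ M * H) * Q ^ M =
      Q ^ M * H * P ^ M - Q ^ M * P ^ M * H - H * P ^ M * Q ^ M + P ^ M * H * Q ^ M := by
    simp only [mul_sub, sub_mul, mul_assoc]; abel
  rw [e, add_apply, sub_apply, sub_apply, inner_add_right, inner_sub_right, inner_sub_right, t2, t3,
    ← r1, ← t0]
  rw [ContinuousLinearMap.smul_def] at t1
  rw [← t1]
  ring

/-! ### The smallness condition (K+Lcond) from (2.24) -/

/-- **(2.24) ⟹ (K+Lcond) for `K + L ≤ 2M`** (KT: "The use of Lemma `hardLemma` is justified since `M` satisfies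
(2.24) which (with `K + L ≤ 2M`) guarantees the condition (K+Lcond)"). [cite: KomaTasaki1994, §5 proof of Theorem 2.4] -/
theorem klCond_of_sq_le (hT : TowerState sys Φ μ γ) {M : ℕ} (hM : 1 ≤ M)
    (h : (M : ℝ) ^ 2 ≤ min (μ ^ 2 / (192 * sys.r)) (sys.obar * μ / Real.sqrt (24 * γ)) * Fintype.card Λ) :
    KLCond sys μ γ (2 * M) := by
  rw [klCond_iff]
  have hN := hT.card_pos_real
  have hμ := hT.mu_pos
  have ho := sys.obar_pos
  have hγ := hT.gamma_pos
  have hr : (2 : ℝ) ≤ sys.r := by exact_mod_cast sys.two_le_r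
  have hr0 : (0 : ℝ) < sys.r := by linarith
  set c := min (μ ^ 2 / (192 * sys.r)) (sys.obar * μ / Real.sqrt (24 * γ)) with hc
  have hc1 : c ≤ μ ^ 2 / (192 * sys.r) := min_le_left _ _
  have hc2 : c ≤ sys.obar * μ / Real.sqrt (24 * γ) := min_le_right _ _
  have hcpos : 0 < c := lt_min (by positivity) (by positivity)
  have hM1 : (1 : ℝ) ≤ M := by exact_mod_cast hM
  have hx : (M : ℝ) ^ 2 / Fintype.card Λ ≤ c := by rw [div_le_iff₀ hN]; exact h
  -- first term `≤ 1/2`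
  have t1 : 48 * sys.r / μ ^ 2 * (((2 * M : ℕ) : ℝ) / Fintype.card Λ) ≤ 1 / 2 := by
    have h1 : ((2 * M : ℕ) : ℝ) / Fintype.card Λ ≤ 2 * (μ ^ 2 / (192 * sys.r)) := by
      push_cast
      calc 2 * (M : ℝ) / Fintype.card Λ ≤ 2 * ((M : ℝ) ^ 2 / Fintype.card Λ) := by
            rw [mul_div_assoc]
            apply mul_le_mul_of_nonneg_left _ (by norm_num)
            apply div_le_div_of_nonneg_right _ hN.le
            nlinarith
        _ ≤ 2 * c := by linarith
        _ ≤ 2 * (μ ^ 2 / (192 * sys.r)) := by linarith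
    calc 48 * sys.r / μ ^ 2 * (((2 * M : ℕ) : ℝ) / Fintype.card Λ)
        ≤ 48 * sys.r / μ ^ 2 * (2 * (μ ^ 2 / (192 * sys.r))) :=
          mul_le_mul_of_nonneg_left h1 (by positivity)
      _ = 1 / 2 := by field_simp; ring
  -- second term `≤ 1/2`
  have t2 : 3 * γ / (2 * sys.obar ^ 2 * μ ^ 2) * ((((2 * M : ℕ) : ℝ)) ^ 3 / (Fintype.card Λ : ℝ) ^ 2) ≤
      1 / 2 := by
    have hsq : (sys.obar * μ / Real.sqrt (24 * γ)) ^ 2 = sys.obar ^ 2 * μ ^ 2 / (24 * γ) := by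
      rw [div_pow, mul_pow, Real.sq_sqrt (by positivity)]
    have hx2 : ((M : ℝ) ^ 2 / Fintype.card Λ) ^ 2 ≤ c ^ 2 := pow_le_pow_left₀ (by positivity) hx 2
    have hc2' : c ^ 2 ≤ sys.obar ^ 2 * μ ^ 2 / (24 * γ) := by
      rw [← hsq]; exact pow_le_pow_left₀ hcpos.le hc2 2
    have h3 : (((2 * M : ℕ) : ℝ)) ^ 3 / (Fintype.card Λ : ℝ) ^ 2 ≤ 8 * (sys.obar ^ 2 * μ ^ 2 / (24 * γ)) := by
      push_cast
      have h4 : (M : ℝ) ^ 3 ≤ (M : ℝ) ^ 4 := by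
        rw [show (M : ℝ) ^ 4 = (M : ℝ) ^ 3 * M by ring]
        exact le_mul_of_one_le_right (by positivity) hM1
      calc (2 * (M : ℝ)) ^ 3 / (Fintype.card Λ : ℝ) ^ 2 = 8 * ((M : ℝ) ^ 3 / (Fintype.card Λ : ℝ) ^ 2) := by
            ring
        _ ≤ 8 * (((M : ℝ) ^ 2 / Fintype.card Λ) ^ 2) := by
            apply mul_le_mul_of_nonneg_left _ (by norm_num)
            rw [div_pow, ← pow_mul]
            exact div_le_div_of_nonneg_right h4 (by positivity)
        _ ≤ 8 * c ^ 2 := by linarith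
        _ ≤ 8 * (sys.obar ^ 2 * μ ^ 2 / (24 * γ)) := by linarith
    calc 3 * γ / (2 * sys.obar ^ 2 * μ ^ 2) * ((((2 * M : ℕ) : ℝ)) ^ 3 / (Fintype.card Λ : ℝ) ^ 2)
        ≤ 3 * γ / (2 * sys.obar ^ 2 * μ ^ 2) * (8 * (sys.obar ^ 2 * μ ^ 2 / (24 * γ))) :=
          mul_le_mul_of_nonneg_left h3 (by positivity)
      _ = 1 / 2 := by field_simp; ring
  linarith

/-! ### The estimate for `M ≥ 1` -/

/-- **(Bunshi)–(Bunbo), the ratio step:** `(M-1) δ([H,O⁺]; M-2, M-1) ≤ M · 4 r h b_M/(μ⁴ o² N²)`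
(`b_{M-2} ≤ b_M/(μoN)⁴`, Lemma `easyLemma`; vacuous for `M = 1`). [cite: KomaTasaki1994, §5 proof of Theorem 2.4, (Bunshi)] -/
theorem pred_mul_delta_one_le (hT : TowerState sys Φ μ γ) {M : ℕ} (hM : 1 ≤ M) :
    ((M : ℝ) - 1) * delta sys Φ (4 * sys.r * sys.obar * sys.hbar) (M - 2) (M - 1) ≤
      M * (4 * sys.r * sys.hbar * bm sys Φ M / (μ ^ 4 * sys.obar ^ 2 * (Fintype.card Λ : ℝ) ^ 2)) := by
  haveI := hT.nonempty
  have hN := hT.card_pos_real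
  have hμ := hT.mu_pos
  have ho := sys.obar_pos
  have hoN := hT.oN_pos
  have hb := hT.bm_pos M
  have hh : 0 ≤ sys.hbar := (norm_nonneg _).trans (sys.norm_h_le (Classical.arbitrary Λ))
  have hr : (0 : ℝ) ≤ sys.r := Nat.cast_nonneg _
  have hRHS : 0 ≤ 4 * sys.r * sys.hbar * bm sys Φ M / (μ ^ 4 * sys.obar ^ 2 * (Fintype.card Λ : ℝ) ^ 2) := by
    positivity
  rcases Nat.lt_or_ge M 2 with h1 | h2
  · have hM1 : M = 1 := by omega
    subst hM1
    simp only [Nat.cast_one, sub_self, zero_mul, one_mul]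
    exact hRHS
  · -- `δ₁ = ½ (4rohN)(2oN) b_{M-2}` and `(μoN)⁴ b_{M-2} ≤ b_M`
    have hb2 := hT.pow_mul_bm_le_add (M - 2) 2
    rw [show M - 2 + 2 = M by omega] at hb2
    have hδ : delta sys Φ (4 * sys.r * sys.obar * sys.hbar) (M - 2) (M - 1) =
        1 / 2 * (4 * sys.r * sys.obar * sys.hbar * Fintype.card Λ) * (2 * sys.oN) * bm sys Φ (M - 2) := by
      rw [delta_comm, delta_of_le _ (by omega : M - 2 ≤ M - 1), show M - 1 - (M - 2) = 1 by omega, pow_one]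
    have hμoN : 0 < ((μ * sys.oN) ^ 2) ^ 2 := by positivity
    have key : bm sys Φ (M - 2) ≤ bm sys Φ M / ((μ * sys.oN) ^ 2) ^ 2 := by
      rw [le_div_iff₀ hμoN]; linarith
    have hδle : delta sys Φ (4 * sys.r * sys.obar * sys.hbar) (M - 2) (M - 1) ≤
        4 * sys.r * sys.hbar * bm sys Φ M / (μ ^ 4 * sys.obar ^ 2 * (Fintype.card Λ : ℝ) ^ 2) := by
      rw [hδ]
      calc 1 / 2 * (4 * sys.r * sys.obar * sys.hbar * Fintype.card Λ) * (2 * sys.oN) * bm sys Φ (M - 2)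
          ≤ 1 / 2 * (4 * sys.r * sys.obar * sys.hbar * Fintype.card Λ) * (2 * sys.oN) *
            (bm sys Φ M / ((μ * sys.oN) ^ 2) ^ 2) := by
            apply mul_le_mul_of_nonneg_left key; positivity
        _ = 4 * sys.r * sys.hbar * bm sys Φ M / (μ ^ 4 * sys.obar ^ 2 * (Fintype.card Λ : ℝ) ^ 2) := by
            rw [U1System.oN_def]; field_simp
    have hM' : (M : ℝ) - 1 ≤ M := by linarith
    calc ((M : ℝ) - 1) * delta sys Φ (4 * sys.r * sys.obar * sys.hbar) (M - 2) (M - 1)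
        ≤ M * delta sys Φ (4 * sys.r * sys.obar * sys.hbar) (M - 2) (M - 1) :=
          mul_le_mul_of_nonneg_right hM' (hT.delta_nonneg (by positivity) _ _)
      _ ≤ _ := mul_le_mul_of_nonneg_left hδle (Nat.cast_nonneg M)

/-- **(Bunshi)–(Bunbo), the ratio step:** `δ([O⁻,[H,O⁺]]; M-1, M-1) ≤ 8 r² h b_M/(μ² N)`
(`b_{M-1} ≤ b_M/(μoN)²`, Lemma `easyLemma`). [cite: KomaTasaki1994, §5 proof of Theorem 2.4, (Bunshi)] -/
theorem delta_two_le (hT : TowerState sys Φ μ γ) {M : ℕ} (hM : 1 ≤ M) :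
    delta sys Φ (4 * sys.r * sys.obar * (4 * sys.r * sys.obar * sys.hbar)) (M - 1) (M - 1) ≤
      8 * sys.r ^ 2 * sys.hbar * bm sys Φ M / (μ ^ 2 * Fintype.card Λ) := by
  haveI := hT.nonempty
  have hN := hT.card_pos_real
  have hμ := hT.mu_pos
  have ho := sys.obar_pos
  have hoN := hT.oN_pos
  have hh : 0 ≤ sys.hbar := (norm_nonneg _).trans (sys.norm_h_le (Classical.arbitrary Λ))
  have hb1 := hT.sq_mul_bm_le_succ (M - 1)
  rw [Nat.sub_add_cancel hM] at hb1
  have hμoN : 0 < (μ * sys.oN) ^ 2 := by positivity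
  have key : bm sys Φ (M - 1) ≤ bm sys Φ M / (μ * sys.oN) ^ 2 := by
    rw [le_div_iff₀ hμoN]; linarith
  rw [delta_def, min_self, max_self, Nat.sub_self, pow_zero, mul_one]
  calc 1 / 2 * (4 * sys.r * sys.obar * (4 * sys.r * sys.obar * sys.hbar) * Fintype.card Λ) * bm sys Φ (M - 1)
      ≤ 1 / 2 * (4 * sys.r * sys.obar * (4 * sys.r * sys.obar * sys.hbar) * Fintype.card Λ) *
        (bm sys Φ M / (μ * sys.oN) ^ 2) := by
        apply mul_le_mul_of_nonneg_left key; positivity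
    _ = 8 * sys.r ^ 2 * sys.hbar * bm sys Φ M / (μ ^ 2 * Fintype.card Λ) := by
        rw [U1System.oN_def]; field_simp; ring

/-- **Theorem 2.4 for `M ≥ 1`** (from the standing hypotheses of Section 5): `(O⁺)^M Φ ≠ 0` and
`|⟨Ψ^{(M)}, H Ψ^{(M)}⟩ - E| ≤ c₃ M²/N` with `c₃ = 24 r² h/μ² + γ h/(8 μ² o²)` (KT's final bound:
`c₃ = 24 r² h μ⁻² {1 + γ o⁻² μ⁻² r⁻¹ c₂}`, and `c₂ ≤ μ²/(192 r)`). [cite: KomaTasaki1994, Theorem 2.4, §5 (Bunshi)–(Bunbo)] -/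
theorem core [CompleteSpace E] (hT : TowerState sys Φ μ γ) {EΛ : ℝ}
    (hH : sys.hamiltonian Φ = (EΛ : ℂ) • Φ) {c : ℂ} (hc : sys.rotation γ Φ = c • Φ)
    (hUH : sys.rotation γ * sys.hamiltonian = sys.hamiltonian * sys.rotation γ) {M : ℕ} (hM : 1 ≤ M)
    (hsmall : (M : ℝ) ^ 2 ≤ min (μ ^ 2 / (192 * sys.r)) (sys.obar * μ / Real.sqrt (24 * γ)) * Fintype.card Λ) :
    (sys.orderPlus ^ M) Φ ≠ 0 ∧
      |(⟪(‖(sys.orderPlus ^ M) Φ‖⁻¹ : ℂ) • (sys.orderPlus ^ M) Φ,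
          sys.hamiltonian ((‖(sys.orderPlus ^ M) Φ‖⁻¹ : ℂ) • (sys.orderPlus ^ M) Φ)⟫_ℂ).re - EΛ| ≤
        (24 * sys.r ^ 2 * sys.hbar / μ ^ 2 + γ * sys.hbar / (8 * μ ^ 2 * sys.obar ^ 2)) * (M : ℝ) ^ 2 /
          Fintype.card Λ := by
  haveI := hT.nonempty
  have hN := hT.card_pos_real
  have hμ := hT.mu_pos
  have ho := sys.obar_pos
  have hγ := hT.gamma_pos
  have hh : 0 ≤ sys.hbar := (norm_nonneg _).trans (sys.norm_h_le (Classical.arbitrary Λ))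
  have hr : (2 : ℝ) ≤ sys.r := by exact_mod_cast sys.two_le_r
  have hr0 : (0 : ℝ) < sys.r := by linarith
  have hKL : KLCond sys μ γ (2 * M) := hT.klCond_of_sq_le hM hsmall
  have hKL' : KLCond sys μ γ (M + M) := by rw [← two_mul]; exact hKL
  have hne : (sys.orderPlus ^ M) Φ ≠ 0 := hT.orderPlus_pow_apply_ne_zero hKL'
  refine ⟨hne, ?_⟩
  set v := (sys.orderPlus ^ M) Φ with hv
  have hS : 1 / 2 * bm sys Φ M ≤ ‖v‖ ^ 2 := hT.half_bm_le_norm_sq hKL'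
  have hb := hT.bm_pos M
  have hvpos : 0 < ‖v‖ ^ 2 := by linarith
  -- the energy in terms of the double commutator
  have hid := hT.two_mul_sub_eq_inner_double_comm hH hc hUH M
  have hB := hT.norm_double_comm_le hKL
  rw [← hid] at hB
  rw [re_inner_normalize_apply]
  have hvv : ⟪v, v⟫_ℂ = ((‖v‖ ^ 2 : ℝ) : ℂ) := by
    rw [inner_self_eq_norm_sq_to_K]; norm_cast
  -- `|re T₁ - E ‖v‖²| ≤ ½ B`
  have hkey : |(⟪v, sys.hamiltonian v⟫_ℂ).re - EΛ * ‖v‖ ^ 2| ≤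
      1 / 2 * ((M : ℝ) * (M * ((M - 1 : ℝ) * (2 * γ * M *
          (3 * delta sys Φ (4 * sys.r * sys.obar * sys.hbar) (M - 2) (M - 1))) +
        3 * delta sys Φ (4 * sys.r * sys.obar * (4 * sys.r * sys.obar * sys.hbar)) (M - 1) (M - 1)))) := by
    have h1 : (⟪v, sys.hamiltonian v⟫_ℂ).re - EΛ * ‖v‖ ^ 2 =
        (⟪v, sys.hamiltonian v⟫_ℂ - (EΛ : ℂ) * ⟪v, v⟫_ℂ).re := by
      rw [hvv, Complex.sub_re, ← Complex.ofReal_mul, Complex.ofReal_re]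
    rw [h1]
    refine (Complex.abs_re_le_norm _).trans ?_
    have h2 : ‖⟪v, sys.hamiltonian v⟫_ℂ - (EΛ : ℂ) * ⟪v, v⟫_ℂ‖ =
        1 / 2 * ‖2 * (⟪v, sys.hamiltonian v⟫_ℂ - (EΛ : ℂ) * ⟪v, v⟫_ℂ)‖ := by
      rw [norm_mul, Complex.norm_ofNat]; ring
    rw [h2]
    exact mul_le_mul_of_nonneg_left hB (by norm_num)
  -- the ratio bounds
  have hR1 := hT.pred_mul_delta_one_le hM
  have hR2 := hT.delta_two_le hM
  have hbound : 1 / 2 * ((M : ℝ) * (M * ((M - 1 : ℝ) * (2 * γ * M *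
          (3 * delta sys Φ (4 * sys.r * sys.obar * sys.hbar) (M - 2) (M - 1))) +
        3 * delta sys Φ (4 * sys.r * sys.obar * (4 * sys.r * sys.obar * sys.hbar)) (M - 1) (M - 1)))) ≤
      1 / 2 * bm sys Φ M * ((M : ℝ) ^ 2 *
        (24 * γ * sys.r * sys.hbar * (M : ℝ) ^ 2 / (μ ^ 4 * sys.obar ^ 2 * (Fintype.card Λ : ℝ) ^ 2) +
          24 * sys.r ^ 2 * sys.hbar / (μ ^ 2 * Fintype.card Λ))) := by
    have hM0 : (0 : ℝ) ≤ M := Nat.cast_nonneg M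
    have e1 : (M : ℝ) * (M * ((M - 1 : ℝ) * (2 * γ * M *
          (3 * delta sys Φ (4 * sys.r * sys.obar * sys.hbar) (M - 2) (M - 1))) +
        3 * delta sys Φ (4 * sys.r * sys.obar * (4 * sys.r * sys.obar * sys.hbar)) (M - 1) (M - 1))) =
        (M : ℝ) ^ 2 * (6 * γ * M * (((M : ℝ) - 1) * delta sys Φ (4 * sys.r * sys.obar * sys.hbar) (M - 2) (M - 1)) +
          3 * delta sys Φ (4 * sys.r * sys.obar * (4 * sys.r * sys.obar * sys.hbar)) (M - 1) (M - 1)) := by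
      ring
    rw [e1]
    have h3 : 6 * γ * M * (((M : ℝ) - 1) * delta sys Φ (4 * sys.r * sys.obar * sys.hbar) (M - 2) (M - 1)) +
        3 * delta sys Φ (4 * sys.r * sys.obar * (4 * sys.r * sys.obar * sys.hbar)) (M - 1) (M - 1) ≤
        6 * γ * M * (M * (4 * sys.r * sys.hbar * bm sys Φ M / (μ ^ 4 * sys.obar ^ 2 * (Fintype.card Λ : ℝ) ^ 2))) +
          3 * (8 * sys.r ^ 2 * sys.hbar * bm sys Φ M / (μ ^ 2 * Fintype.card Λ)) := by
      have := mul_le_mul_of_nonneg_left hR1 (by positivity : (0 : ℝ) ≤ 6 * γ * M)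
      linarith
    have e2 : 6 * γ * M * (M * (4 * sys.r * sys.hbar * bm sys Φ M / (μ ^ 4 * sys.obar ^ 2 * (Fintype.card Λ : ℝ) ^ 2))) +
          3 * (8 * sys.r ^ 2 * sys.hbar * bm sys Φ M / (μ ^ 2 * Fintype.card Λ)) =
        bm sys Φ M * (24 * γ * sys.r * sys.hbar * (M : ℝ) ^ 2 / (μ ^ 4 * sys.obar ^ 2 * (Fintype.card Λ : ℝ) ^ 2) +
          24 * sys.r ^ 2 * sys.hbar / (μ ^ 2 * Fintype.card Λ)) := by
      ring
    rw [e2] at h3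
    have h4 := mul_le_mul_of_nonneg_left h3 (by positivity : (0 : ℝ) ≤ (M : ℝ) ^ 2)
    calc 1 / 2 * ((M : ℝ) ^ 2 * (6 * γ * M * (((M : ℝ) - 1) *
            delta sys Φ (4 * sys.r * sys.obar * sys.hbar) (M - 2) (M - 1)) +
          3 * delta sys Φ (4 * sys.r * sys.obar * (4 * sys.r * sys.obar * sys.hbar)) (M - 1) (M - 1)))
        ≤ 1 / 2 * ((M : ℝ) ^ 2 * (bm sys Φ M *
          (24 * γ * sys.r * sys.hbar * (M : ℝ) ^ 2 / (μ ^ 4 * sys.obar ^ 2 * (Fintype.card Λ : ℝ) ^ 2) +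
            24 * sys.r ^ 2 * sys.hbar / (μ ^ 2 * Fintype.card Λ)))) :=
          mul_le_mul_of_nonneg_left h4 (by norm_num)
      _ = _ := by ring
  -- divide by `‖v‖² ≥ ½ b_M`
  have hX : 0 ≤ (M : ℝ) ^ 2 *
      (24 * γ * sys.r * sys.hbar * (M : ℝ) ^ 2 / (μ ^ 4 * sys.obar ^ 2 * (Fintype.card Λ : ℝ) ^ 2) +
        24 * sys.r ^ 2 * sys.hbar / (μ ^ 2 * Fintype.card Λ)) := by positivity
  have hfin : |(⟪v, sys.hamiltonian v⟫_ℂ).re / ‖v‖ ^ 2 - EΛ| ≤ (M : ℝ) ^ 2 *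
      (24 * γ * sys.r * sys.hbar * (M : ℝ) ^ 2 / (μ ^ 4 * sys.obar ^ 2 * (Fintype.card Λ : ℝ) ^ 2) +
        24 * sys.r ^ 2 * sys.hbar / (μ ^ 2 * Fintype.card Λ)) := by
    have e : (⟪v, sys.hamiltonian v⟫_ℂ).re / ‖v‖ ^ 2 - EΛ =
        ((⟪v, sys.hamiltonian v⟫_ℂ).re - EΛ * ‖v‖ ^ 2) / ‖v‖ ^ 2 := by
      field_simp
    rw [e, abs_div, abs_of_pos hvpos, div_le_iff₀ hvpos]
    refine (hkey.trans hbound).trans ?_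
    calc 1 / 2 * bm sys Φ M * ((M : ℝ) ^ 2 *
          (24 * γ * sys.r * sys.hbar * (M : ℝ) ^ 2 / (μ ^ 4 * sys.obar ^ 2 * (Fintype.card Λ : ℝ) ^ 2) +
            24 * sys.r ^ 2 * sys.hbar / (μ ^ 2 * Fintype.card Λ)))
        ≤ ‖v‖ ^ 2 * ((M : ℝ) ^ 2 *
          (24 * γ * sys.r * sys.hbar * (M : ℝ) ^ 2 / (μ ^ 4 * sys.obar ^ 2 * (Fintype.card Λ : ℝ) ^ 2) +
            24 * sys.r ^ 2 * sys.hbar / (μ ^ 2 * Fintype.card Λ))) :=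
          mul_le_mul_of_nonneg_right hS hX
      _ = _ := by ring
  refine hfin.trans ?_
  -- `M²/N ≤ μ²/(192 r)` in the quartic term
  have hx : (M : ℝ) ^ 2 / Fintype.card Λ ≤ μ ^ 2 / (192 * sys.r) := by
    rw [div_le_iff₀ hN]; exact hsmall.trans (mul_le_mul_of_nonneg_right (min_le_left _ _) hN.le)
  have h5 : 24 * γ * sys.r * sys.hbar * (M : ℝ) ^ 2 / (μ ^ 4 * sys.obar ^ 2 * (Fintype.card Λ : ℝ) ^ 2) ≤
      γ * sys.hbar / (8 * μ ^ 2 * sys.obar ^ 2) / Fintype.card Λ := by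
    have e : 24 * γ * sys.r * sys.hbar * (M : ℝ) ^ 2 / (μ ^ 4 * sys.obar ^ 2 * (Fintype.card Λ : ℝ) ^ 2) =
        (24 * γ * sys.r * sys.hbar / (μ ^ 4 * sys.obar ^ 2 * Fintype.card Λ)) * ((M : ℝ) ^ 2 / Fintype.card Λ) := by
      field_simp
    rw [e]
    calc (24 * γ * sys.r * sys.hbar / (μ ^ 4 * sys.obar ^ 2 * Fintype.card Λ)) * ((M : ℝ) ^ 2 / Fintype.card Λ)
        ≤ (24 * γ * sys.r * sys.hbar / (μ ^ 4 * sys.obar ^ 2 * Fintype.card Λ)) * (μ ^ 2 / (192 * sys.r)) :=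
          mul_le_mul_of_nonneg_left hx (by positivity)
      _ = γ * sys.hbar / (8 * μ ^ 2 * sys.obar ^ 2) / Fintype.card Λ := by
          field_simp; ring
  calc (M : ℝ) ^ 2 * (24 * γ * sys.r * sys.hbar * (M : ℝ) ^ 2 / (μ ^ 4 * sys.obar ^ 2 * (Fintype.card Λ : ℝ) ^ 2) +
        24 * sys.r ^ 2 * sys.hbar / (μ ^ 2 * Fintype.card Λ))
      ≤ (M : ℝ) ^ 2 * (γ * sys.hbar / (8 * μ ^ 2 * sys.obar ^ 2) / Fintype.card Λ +
        24 * sys.r ^ 2 * sys.hbar / (μ ^ 2 * Fintype.card Λ)) := by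
        apply mul_le_mul_of_nonneg_left _ (by positivity)
        linarith
    _ = (24 * sys.r ^ 2 * sys.hbar / μ ^ 2 + γ * sys.hbar / (8 * μ ^ 2 * sys.obar ^ 2)) * (M : ℝ) ^ 2 /
          Fintype.card Λ := by
        field_simp; ring

end TowerState

/-! ### From the hypotheses of Theorem 2.4 to the standing hypotheses of Section 5 -/

/-- The hypotheses of Theorem 2.4 (i)–vi), `γ > 0`, `N ≥ 1`) give the standing hypotheses
`TowerState` of Section 5; in particular `C Φ = 0`. [cite: KomaTasaki1994, §5 proof of Theorem 2.4] -/
theorem IsLROEigenstate.towerState [FiniteDimensional ℂ E] {sys : U1System Λ E} {Φ : E} {EΛ μ : ℝ}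
    (hΦ : IsLROEigenstate sys Φ EΛ μ) {γ : ℝ} (hγ : 0 < γ)
    (hv : sys.order 0 * sys.order 1 - sys.order 1 * sys.order 0 = (I * γ) • sys.C)
    (hUΦ : ∃ c : ℂ, sys.rotation γ Φ = c • Φ) (hN : 0 < Fintype.card Λ) : TowerState sys Φ μ γ := by
  haveI : CompleteSpace E := FiniteDimensional.complete ℂ E
  obtain ⟨c, hc⟩ := hUΦ
  obtain ⟨c', hc'⟩ := hΦ.eigen_C
  have hΦ0 : Φ ≠ 0 := by
    intro h; have := hΦ.norm_eq_one; rw [h, norm_zero] at this; exact zero_ne_one this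
  have hC : sys.C Φ = 0 := U1System.C_apply_eq_zero_of_rotation hγ hv hΦ0 hc hc'
  exact ⟨hΦ.norm_eq_one, hC, hΦ.mu_pos, hΦ.mu_le_one, hγ, hN, hΦ.lro, hv⟩

/-- (2.24) with `M ≠ 0` forces `N ≥ 1`. [cite: KomaTasaki1994, Theorem 2.4 (2.24)] -/
theorem card_pos_of_sq_le (sys : U1System Λ E) {μ γ : ℝ} {M : ℤ} (hM : M ≠ 0)
    (h : (M : ℝ) ^ 2 ≤ min (μ ^ 2 / (192 * sys.r)) (sys.obar * μ / Real.sqrt (24 * γ)) * Fintype.card Λ) :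
    0 < Fintype.card Λ := by
  by_contra hN
  have h0 : Fintype.card Λ = 0 := by omega
  rw [h0, Nat.cast_zero, mul_zero] at h
  have h1 : (1 : ℝ) ≤ (M : ℝ) ^ 2 := by
    have : (1 : ℤ) ≤ M ^ 2 := by nlinarith [sq_nonneg M, Int.one_le_abs hM, sq_abs M]
    exact_mod_cast this
  linarith

/-! ### The mirror system and `M < 0` -/

namespace U1System

variable (sys : U1System Λ E)

/-- The lowering operator of the mirror system is `O⁺`. [cite: KomaTasaki1994, §4] -/
theorem mirror_orderMinus : sys.mirror.orderMinus = sys.orderPlus := by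
  rw [orderPlus, orderMinus, mirror_order_zero, mirror_order_one, smul_neg, sub_neg_eq_add]

/-- The `π`-rotation `U` of the mirror system is the same operator. [cite: KomaTasaki1994, §4] -/
theorem mirror_rotation (γ : ℝ) : sys.mirror.rotation γ = sys.rotation γ := rfl

/-- v) `[O⁽¹⁾, O⁽²⁾] = iγ C` is preserved by the mirror (same `γ`). [cite: KomaTasaki1994, §4] -/
theorem mirror_comm {γ : ℝ}
    (hv : sys.order 0 * sys.order 1 - sys.order 1 * sys.order 0 = (I * γ) • sys.C) :
    sys.mirror.order 0 * sys.mirror.order 1 - sys.mirror.order 1 * sys.mirror.order 0 =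
      (I * γ) • sys.mirror.C := by
  rw [mirror_order_zero, mirror_order_one, mirror_C, mul_neg, neg_mul, sub_neg_eq_add, smul_neg, ← hv]
  abel

end U1System

/-! ### Theorem 2.4 -/

/-- **KT Theorem 2.4 — PROVED.** The named fact `theorem_2_4` holds, with
`c₃(h, o, r, μ, γ) = 24 r² h/μ² + γ h/(8 μ² o²)`: under i)–vi) and (2.24), `(O⁺)^M Φ ≠ 0` and
`|⟨Ψ^{(M)}, H Ψ^{(M)}⟩ - E| ≤ c₃ M²/N`. [cite: KomaTasaki1994, Theorem 2.4] -/
theorem theorem_2_4_holds : theorem_2_4.{u, v} := by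
  refine ⟨fun hbar obar r μ γ => 24 * r ^ 2 * hbar / μ ^ 2 + γ * hbar / (8 * μ ^ 2 * obar ^ 2), ?_⟩
  intro Λ _ E _ _ _ sys Φ EΛ μ hΦ γ hγ hv hUH hUΦ M hM0 hM
  haveI : CompleteSpace E := FiniteDimensional.complete ℂ E
  have hN : 0 < Fintype.card Λ := card_pos_of_sq_le sys hM0 hM
  change sys.rotation γ * sys.hamiltonian = sys.hamiltonian * sys.rotation γ at hUH
  change ∃ c : ℂ, sys.rotation γ Φ = c • Φ at hUΦ
  unfold U1System.trialState
  rcases lt_or_gt_of_ne hM0 with hneg | hpos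
  · -- `M < 0`: the conjugate system with `-M > 0`
    obtain ⟨M', hM'⟩ : ∃ M' : ℕ, (M' : ℤ) = -M := ⟨(-M).toNat, Int.toNat_of_nonneg (by omega)⟩
    have hM'1 : 1 ≤ M' := by omega
    have hT : TowerState sys.mirror Φ μ γ :=
      hΦ.mirror.towerState hγ (sys.mirror_comm hv) hUΦ hN
    obtain ⟨c, hc⟩ := hUΦ
    have hsmall : (M' : ℝ) ^ 2 ≤ min (μ ^ 2 / (192 * sys.mirror.r))
        (sys.mirror.obar * μ / Real.sqrt (24 * γ)) * Fintype.card Λ := by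
      have e : (M' : ℝ) ^ 2 = (M : ℝ) ^ 2 := by
        have : (M' : ℝ) = -(M : ℝ) := by exact_mod_cast hM'
        rw [this, neg_sq]
      rw [e]; exact hM
    obtain ⟨hne, hbd⟩ := hT.core hΦ.eigen_hamiltonian (c := c) hc hUH hM'1 hsmall
    rw [U1System.mirror_orderPlus] at hne
    rw [U1System.mirror_orderPlus, U1System.mirror_hamiltonian] at hbd
    have hpow : sys.orderPow M = sys.orderMinus ^ M' := by
      rw [sys.orderPow_of_neg hneg, ← hM', Int.toNat_natCast]
    have hpowΦ : sys.orderPow M Φ = (sys.orderMinus ^ M') Φ := by rw [hpow]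
    rw [hpowΦ]
    refine ⟨hne, ?_⟩
    have e : (M : ℝ) ^ 2 = (M' : ℝ) ^ 2 := by
      have : (M' : ℝ) = -(M : ℝ) := by exact_mod_cast hM'
      rw [this, neg_sq]
    rw [e]
    exact hbd
  · -- `M > 0`
    obtain ⟨M', hM'⟩ : ∃ M' : ℕ, (M' : ℤ) = M := ⟨M.toNat, Int.toNat_of_nonneg hpos.le⟩
    have hM'1 : 1 ≤ M' := by omega
    have hT : TowerState sys Φ μ γ := hΦ.towerState hγ hv hUΦ hN
    obtain ⟨c, hc⟩ := hUΦ
    have e : (M : ℝ) ^ 2 = (M' : ℝ) ^ 2 := by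
      have : (M' : ℝ) = (M : ℝ) := by exact_mod_cast hM'
      rw [this]
    have hsmall : (M' : ℝ) ^ 2 ≤ min (μ ^ 2 / (192 * sys.r)) (sys.obar * μ / Real.sqrt (24 * γ)) *
        Fintype.card Λ := by rw [← e]; exact hM
    obtain ⟨hne, hbd⟩ := hT.core hΦ.eigen_hamiltonian (c := c) hc hUH hM'1 hsmall
    have hpow : sys.orderPow M = sys.orderPlus ^ M' := by
      rw [sys.orderPow_of_nonneg hpos.le, ← hM', Int.toNat_natCast]
    have hpowΦ : sys.orderPow M Φ = (sys.orderPlus ^ M') Φ := by rw [hpow]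
    rw [hpowΦ, e]
    exact ⟨hne, hbd⟩

end Literature.MathematicalPhysics.QuantumLattice.KomaTasaki
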